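import Summits.Ventures.PercRepro.C026C028Defs
import Summits.Ventures.PercRepro.C026GluingIndep

/-!
# C-028(c) composes over a 3-terminal gluing (p6, gen 15; mine-3 MINE3-GLUING §2–§3)

mine-3's C-028 state of a marked multigraph is `(Z, Mₐ, M_b, K)` = `(P(a|b|c), P(b iso), P(a iso),
P(c iso))`, and ROW C-028(c) reads `K ≥ Φ(Z/Mₐ, Z/M_b)` (`C028At_iff_phi`).  Over p6's 3-terminal
gluing `IsGluing a b c side` every coordinate MULTIPLIES (`prob_isoMark_gluing`, `law3_four_gluing`), the
`Φ`-arguments multiply with them, and LEMMA G2 (`c028Phi_mul_le`, `Φ(xx', yy') ≤ Φ⁺(x, y)·Φ⁺(x', y')`)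
closes: **C-028(c) in `Φ`-form on both sides gives C-028(c) on the gluing** (`C028At_of_gluing`).  The
sides' data are read on the side restrictions (`c028SideIso`, `c028SideSepAll`), so the theorem iterates along a
tree of gluings — the composition step of the forest-class theorem (C-035 on every `G` with
`G − a − b` a forest).
-/

namespace PercRepro

open Finset

namespace MultiGraph

variable {V E : Type*} (G : MultiGraph V E) [Fintype E] [DecidableEq E]

/-! ### The rows as isolation events -/

/-- `Mₐ = P(b iso) = y₂ + z`. -/
theorem law3_two_add_four_eq_isoMark (p : E → ℝ) (a b c : V) :
    G.law3 p a b c 2 + G.law3 p a b c 4 = prob p {ω | G.IsoMark ω b a c} := by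
  rw [law3_two, law3_four, G.partitionEvent_row_ac_b, G.partitionEvent_row_a_b_c]
  have h := prob_inter_add_prob_inter_compl p {ω | G.IsoMark ω b a c} (G.connEvent a c)
  have h1 : {ω | G.IsoMark ω b a c} ∩ G.connEvent a c = G.connEvent a c ∩ G.sepEvent a b := by
    ext ω
    simp only [Set.mem_inter_iff, Set.mem_setOf_eq, IsoMark, mem_connEvent, mem_sepEvent]
    constructor
    · rintro ⟨⟨hba, _⟩, hac⟩
      exact ⟨hac, fun h => hba h.symm⟩
    · rintro ⟨hac, hab⟩
      exact ⟨⟨fun h => hab h.symm, fun h => hab (hac.trans h.symm)⟩, hac⟩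
  have h2 : {ω | G.IsoMark ω b a c} ∩ (G.connEvent a c)ᶜ =
      G.sepEvent a b ∩ G.sepEvent a c ∩ G.sepEvent b c := by
    ext ω
    simp only [Set.mem_inter_iff, Set.mem_setOf_eq, IsoMark, Set.mem_compl_iff, mem_connEvent,
      mem_sepEvent]
    constructor
    · rintro ⟨⟨hba, hbc⟩, hac⟩
      exact ⟨⟨fun h => hba h.symm, hac⟩, hbc⟩
    · rintro ⟨⟨hab, hac⟩, hbc⟩
      exact ⟨⟨fun h => hab h.symm, hbc⟩, hac⟩
  rw [h1, h2] at h
  exact h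

/-- `M_b = P(a iso) = y₃ + z`. -/
theorem law3_three_add_four_eq_isoMark (p : E → ℝ) (a b c : V) :
    G.law3 p a b c 3 + G.law3 p a b c 4 = prob p {ω | G.IsoMark ω a b c} := by
  rw [law3_three, law3_four, G.partitionEvent_row_bc_a, G.partitionEvent_row_a_b_c]
  have h := prob_inter_add_prob_inter_compl p {ω | G.IsoMark ω a b c} (G.connEvent b c)
  have h1 : {ω | G.IsoMark ω a b c} ∩ G.connEvent b c = G.connEvent b c ∩ G.sepEvent a b := by
    ext ω
    simp only [Set.mem_inter_iff, Set.mem_setOf_eq, IsoMark, mem_connEvent, mem_sepEvent]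
    constructor
    · rintro ⟨⟨hab, _⟩, hbc⟩
      exact ⟨hbc, hab⟩
    · rintro ⟨hbc, hab⟩
      exact ⟨⟨hab, fun h => hab (h.trans hbc.symm)⟩, hbc⟩
  have h2 : {ω | G.IsoMark ω a b c} ∩ (G.connEvent b c)ᶜ =
      G.sepEvent a b ∩ G.sepEvent a c ∩ G.sepEvent b c := by
    ext ω
    simp only [Set.mem_inter_iff, Set.mem_setOf_eq, IsoMark, Set.mem_compl_iff, mem_connEvent,
      mem_sepEvent]
  rw [h1, h2] at h
  exact h

/-- `K = P(c iso) = y₁ + z`. -/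
theorem law3_one_add_four_eq_isoMark (p : E → ℝ) (a b c : V) :
    G.law3 p a b c 1 + G.law3 p a b c 4 = prob p {ω | G.IsoMark ω c a b} := by
  rw [G.law3_one_add_four]
  congr 1
  ext ω
  simp only [Set.mem_inter_iff, Set.mem_setOf_eq, IsoMark, mem_sepEvent]
  constructor
  · rintro ⟨hac, hbc⟩
    exact ⟨fun h => hac h.symm, fun h => hbc h.symm⟩
  · rintro ⟨hca, hcb⟩
    exact ⟨fun h => hca h.symm, fun h => hcb h.symm⟩

/-- `Z = P(a|b|c)` as the conjunction of two isolations. -/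
theorem law3_four_eq_isoMark (p : E → ℝ) (a b c : V) :
    G.law3 p a b c 4 = prob p {ω | G.IsoMark ω a b c ∧ G.IsoMark ω b a c} := by
  rw [law3_four, G.partitionEvent_row_a_b_c]
  congr 1
  ext ω
  simp only [Set.mem_inter_iff, Set.mem_setOf_eq, IsoMark, mem_sepEvent]
  constructor
  · rintro ⟨⟨hab, hac⟩, hbc⟩
    exact ⟨⟨hab, hac⟩, fun h => hab h.symm, hbc⟩
  · rintro ⟨⟨hab, hac⟩, _, hbc⟩
    exact ⟨⟨hab, hac⟩, hbc⟩

/-! ### The sides of a gluing -/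

/-- The isolation of `m` from `x`, `y` read on the side-`s` restriction. -/
def c028SideIso (side : E → Bool) (s : Bool) (m x y : V) : Set (Config E) :=
  {ω | (G.part side s).IsoMark (sideRestrict ω side s) m x y}

/-- All three marks mutually isolated, read on the side-`s` restriction. -/
def c028SideSepAll (side : E → Bool) (s : Bool) (a b c : V) : Set (Config E) :=
  {ω | (G.part side s).IsoMark (sideRestrict ω side s) a b c ∧
    (G.part side s).IsoMark (sideRestrict ω side s) b a c}

/-- `Z` multiplies over the gluing. -/
theorem law3_four_gluing {a b c : V} {side : E → Bool} (hg : G.IsGluing a b c side) (p : E → ℝ) :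
    G.law3 p a b c 4 = prob p (G.c028SideSepAll side true a b c) * prob p (G.c028SideSepAll side false a b c) := by
  rw [G.law3_four_eq_isoMark]
  unfold c028SideSepAll
  rw [← prob_inter_eq_mul_of_sides p side
    (fun τ => (G.part side true).IsoMark τ a b c ∧ (G.part side true).IsoMark τ b a c)
    (fun τ => (G.part side false).IsoMark τ a b c ∧ (G.part side false).IsoMark τ b a c)]
  congr 1
  ext ω
  simp only [Set.mem_setOf_eq, Set.mem_inter_iff]
  rw [G.isoMark_gluing_iff hg ω (m := a) (x := b) (y := c) (by
      intro w hw hwa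
      rcases hw with h | h | h
      · exact absurd h hwa
      · exact Or.inl h
      · exact Or.inr h),
    G.isoMark_gluing_iff hg ω (m := b) (x := a) (y := c) (by
      intro w hw hwb
      rcases hw with h | h | h
      · exact Or.inl h
      · exact absurd h hwb
      · exact Or.inr h)]
  tauto

/-- `Mₐ`, `M_b`, `K` multiply over the gluing. -/
theorem isoMark_gluing_prod {a b c : V} {side : E → Bool} (hg : G.IsGluing a b c side) (p : E → ℝ) :
    prob p {ω | G.IsoMark ω b a c} =
        prob p (G.c028SideIso side true b a c) * prob p (G.c028SideIso side false b a c) ∧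
      prob p {ω | G.IsoMark ω a b c} =
        prob p (G.c028SideIso side true a b c) * prob p (G.c028SideIso side false a b c) ∧
      prob p {ω | G.IsoMark ω c a b} =
        prob p (G.c028SideIso side true c a b) * prob p (G.c028SideIso side false c a b) := by
  refine ⟨?_, ?_, ?_⟩
  · exact G.prob_isoMark_gluing hg p (m := b) (x := a) (y := c) (by
      intro w hw hwb
      rcases hw with h | h | h
      · exact Or.inl h
      · exact absurd h hwb
      · exact Or.inr h)
  · exact G.prob_isoMark_gluing hg p (m := a) (x := b) (y := c) (by
      intro w hw hwa
      rcases hw with h | h | h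
      · exact absurd h hwa
      · exact Or.inl h
      · exact Or.inr h)
  · exact G.prob_isoMark_gluing hg p (m := c) (x := a) (y := b) (by
      intro w hw hwc
      rcases hw with h | h | h
      · exact Or.inl h
      · exact Or.inr h
      · exact absurd h hwc)

omit [Fintype E] [DecidableEq E] in
/-- `c028SideSepAll ⊆ c028SideIso b a c` and `⊆ c028SideIso a b c`. -/
theorem sideSepAll_subset (side : E → Bool) (s : Bool) (a b c : V) :
    G.c028SideSepAll side s a b c ⊆ G.c028SideIso side s b a c ∧
      G.c028SideSepAll side s a b c ⊆ G.c028SideIso side s a b c :=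
  ⟨fun _ h => h.2, fun _ h => h.1⟩

/-- **C-028(c) composes over a gluing** (mine-3 §3): if both sides satisfy C-028(c) in `Φ`-form —
`K_s ≥ Φ(Z_s/Mₐ_s, Z_s/M_b_s)` with `Z_s > 0` — so does the gluing. -/
theorem C028At_of_gluing {a b c : V} {side : E → Bool} (hg : G.IsGluing a b c side) {p : E → ℝ}
    (hp : IsProb p)
    (hZT : 0 < prob p (G.c028SideSepAll side true a b c))
    (hZF : 0 < prob p (G.c028SideSepAll side false a b c))
    (hT : c028Phi (prob p (G.c028SideSepAll side true a b c) / prob p (G.c028SideIso side true b a c))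
        (prob p (G.c028SideSepAll side true a b c) / prob p (G.c028SideIso side true a b c)) ≤
      prob p (G.c028SideIso side true c a b))
    (hF : c028Phi (prob p (G.c028SideSepAll side false a b c) / prob p (G.c028SideIso side false b a c))
        (prob p (G.c028SideSepAll side false a b c) / prob p (G.c028SideIso side false a b c)) ≤
      prob p (G.c028SideIso side false c a b)) :
    G.C028At p a b c := by
  obtain ⟨hMa, hMb, hK⟩ := G.isoMark_gluing_prod hg p
  have hZ := G.law3_four_gluing hg p
  have hZpos : 0 < G.law3 p a b c 4 := by rw [hZ]; exact mul_pos hZT hZF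
  rw [G.C028At_iff_phi hp hZpos, G.law3_two_add_four_eq_isoMark, G.law3_three_add_four_eq_isoMark,
    G.law3_one_add_four_eq_isoMark, hMa, hMb, hK, hZ]
  -- the `Φ`-arguments of the sides lie in `[0, 1]`
  have hsub := fun s => G.sideSepAll_subset side s a b c
  have hMaT : prob p (G.c028SideSepAll side true a b c) ≤ prob p (G.c028SideIso side true b a c) :=
    prob_mono hp (hsub true).1
  have hMbT : prob p (G.c028SideSepAll side true a b c) ≤ prob p (G.c028SideIso side true a b c) :=
    prob_mono hp (hsub true).2
  have hMaF : prob p (G.c028SideSepAll side false a b c) ≤ prob p (G.c028SideIso side false b a c) :=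
    prob_mono hp (hsub false).1
  have hMbF : prob p (G.c028SideSepAll side false a b c) ≤ prob p (G.c028SideIso side false a b c) :=
    prob_mono hp (hsub false).2
  have hMaT0 : 0 < prob p (G.c028SideIso side true b a c) := lt_of_lt_of_le hZT hMaT
  have hMbT0 : 0 < prob p (G.c028SideIso side true a b c) := lt_of_lt_of_le hZT hMbT
  have hMaF0 : 0 < prob p (G.c028SideIso side false b a c) := lt_of_lt_of_le hZF hMaF
  have hMbF0 : 0 < prob p (G.c028SideIso side false a b c) := lt_of_lt_of_le hZF hMbF
  have e1 : prob p (G.c028SideSepAll side true a b c) * prob p (G.c028SideSepAll side false a b c) /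
      (prob p (G.c028SideIso side true b a c) * prob p (G.c028SideIso side false b a c)) =
      prob p (G.c028SideSepAll side true a b c) / prob p (G.c028SideIso side true b a c) *
        (prob p (G.c028SideSepAll side false a b c) / prob p (G.c028SideIso side false b a c)) :=
    (div_mul_div_comm _ _ _ _).symm
  have e2 : prob p (G.c028SideSepAll side true a b c) * prob p (G.c028SideSepAll side false a b c) /
      (prob p (G.c028SideIso side true a b c) * prob p (G.c028SideIso side false a b c)) =
      prob p (G.c028SideSepAll side true a b c) / prob p (G.c028SideIso side true a b c) *
        (prob p (G.c028SideSepAll side false a b c) / prob p (G.c028SideIso side false a b c)) :=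
    (div_mul_div_comm _ _ _ _).symm
  rw [e1, e2]
  have hKT0 : 0 ≤ prob p (G.c028SideIso side true c a b) := prob_nonneg hp _
  have hKF0 : 0 ≤ prob p (G.c028SideIso side false c a b) := prob_nonneg hp _
  have hG2 := c028Phi_mul_le (div_nonneg hZT.le hMaT0.le) ((div_le_one hMaT0).2 hMaT)
    (div_nonneg hZT.le hMbT0.le) ((div_le_one hMbT0).2 hMbT)
    (div_nonneg hZF.le hMaF0.le) ((div_le_one hMaF0).2 hMaF)
    (div_nonneg hZF.le hMbF0.le) ((div_le_one hMbF0).2 hMbF)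
  refine le_trans hG2 (mul_le_mul ?_ ?_ (le_max_right _ _) hKT0)
  · exact max_le hT hKT0
  · exact max_le hF hKF0

end MultiGraph

end PercRepro
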